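import Summits.ABC.IUTFork.Conditional.AbcOfSGenuineMTameRobust
import Summits.ABC.IUTFork.Conditional.AbcOfSGenuineKTameRobustTate
import HarnessLib

/-!
# M LINE twin of the robust tame-exact refutation with the TATE-EXACT local type: UNCONDITIONAL per-datum refutations of the
# hull-level clause S_H at the M-level sharp setting over abc-triple data with pole prime `p ≥ 10·l + 2` (`3 ∣ v_p(abc)`) or
# `p ≥ 6·l + 2` (`5 ∣ v_p(abc)`) — abc-iut-W-ref-2's `AbcOfSGenuineKTameRobustTate` (p465202) VERBATIM at `settingPrVolSharpM`

PROOF-ONLY file (no `def`, no new `Prop`, no instance) of the abc-iut cell (seat abc-iut-W-ref-1, gen 3; director-abc g3 MINT-LIST BATCH 1,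
ROW «TARGETS.tsv 043f473bc4159fa7 kind TE rows 1–25», M column; HOME/STATUS «W:M-TE-ROBUST»; sequel of this seat's `AbcOfSGenuineMTameRobust`).
TAKES NO SIDE on [IUTchIII] Cor. 3.12 or on any author. The LOCAL-TYPE binder of `GenuineM.not_pilotKummerCompatHull_ratPoint_of_localType` is
DISCHARGED by abc-iut-W-ref-2's / abc-iut-w4-d087's Tate-exact local type (Serre 1972 n° 1.12, unramified half, proved in the tree from Kodaira–Néron):
at a rational point, over a pole prime `p ∉ {2, 3, 5, l}` of `j(λ)` with `3 ∣ ord_p j(λ)` (resp. `5 ∣`), EVERY place `w | p` of `T.K` has `e(w | p) ∣ 10·l`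
(resp. `∣ 6·l`) — `Cor22.ThetaVolumeDatumAt.ramificationIdx_int_dvd_ten_mul_ratPoint'` / `…_six_mul_ratPoint'`; for an abc triple `ord_p j(a/c) = −2·v_p(abc)`
exactly (`Cor22.ord_jInv_ratPoint_triple_eq`). The member's `K_{x₀}` IS the rescaled completion of `T.K` at `placeOfM x₀`.
* `GenuineM.not_pilotKummerCompatHull_triple_of_ten_top` — `p_u ∉ {2,3,5,l}`, **`10·l + 2 ≤ p_u`**, `p_u^v ∥ abc` with **`3 ∣ v`**, top label `2l ≤ (l−3)·v`
  ⇒ ¬ S_H at the M-level sharp setting of every genuine Θ-volume datum over `(ratPoint (a/c), l)` (own ideles, pinned reading), every choice of the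
  free context binders and Kummer datum;
* `GenuineM.not_pilotKummerCompatHull_triple_of_six_top` — the same with **`6·l + 2 ≤ p_u`** and **`5 ∣ v`**.
HONEST SCOPE as in the parents: SHARP reading; per-label licence STRONGER than print; admissibility / Szpiro-badness / (P6) / non-emptiness of the
datum type NOT claimed (apex inputs); «refuted as typed» ≠ «refuted in print»; nothing about the printed GLOBAL inequality or the NUMBER-level
Corollary; typed ≠ proved; instantiated ≠ endorsed. [cite: Mochizuki2012, IUTchIII Cor. 3.12 Step (xi-f) p. 184; IUTchIV Prop. 1.2 (i)(ii) p. 10,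
Thm. 1.10 proof Steps (ii)–(iii) p. 24–26, Cor. 2.2 (ii) proof p. 44] [cite: Serre1972, §1.11–§1.12] [cite: MochizukiGenEll2010, Thm. 2.1 p. 11]
[cite: DupuyHilado2025, §3.3, §3.4, §4.9] [claim: Mochizuki2012, status: disputed] for every IUT sentence quoted.
-/

noncomputable section

open Set Function NumberField IsDedekindDomain

namespace Summit.ABC.IUTFork.Conditional

open Thm311 Thm311.Real Cor312 Cor312Vol Cor312Prov Literature.IUT.LogThetaLattice Literature.IUT.LogVolume
  Literature.IUT.HodgeTheaters Literature.IUT.LogVolume.ThetaData Literature.IUT.LogVolume.Cor22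
open Literature.NumberTheory.NumberFields Literature.NumberTheory.GaloisRepresentations.Ultrametric
open Literature.NumberTheory.DiophantineGeometry Literature.NumberTheory.DiophantineGeometry.GenEll Summit.ABC.ABC.Theorems

/-- **M LINE, abc-TRIPLE form, TOP LABEL `j = l⋆`, prime floor `10·l + 2`, Tate-exact local type.** `a + b = c` coprime, `λ = a/c`, `T` a genuine
Θ-volume datum at `(ratPoint (a/c), l)`, a finite place `u` of `ℚ` with `p = p_u ∉ {2, 3, 5, l}`, **`10·l + 2 ≤ p`**, `p^v ∣ abc`, `p^{v+1} ∤ abc`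
(`v = v_p(abc) ≥ 1`) with **`3 ∣ v`**, and **`2l ≤ (l−3)·v`**. THEN ¬ S_H at the summand-route M-level sharp setting of `T`'s own read-off ideles (pinned
reading) for every choice of the free context binders and Kummer datum — UNCONDITIONALLY: `ord_p j(a/c) = −2v` (`Cor22.ord_jInv_ratPoint_triple_eq`), so
`3 ∣ ord_p j(a/c)` and every `w | p` of `T.K` has `e(w | p) ∣ 10·l ≤ p − 2` (`Cor22.ThetaVolumeDatumAt.ramificationIdx_int_dvd_ten_mul_ratPoint'`, Serre 1972 n° 1.12),
and `GenuineM.not_pilotKummerCompatHull_ratPoint_of_localType` fires at the top label. [cite: Mochizuki2012, IUTchIII Cor. 3.12 Step (xi-f) p. 184;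
IUTchIV Thm. 1.10 proof Steps (ii)–(iii) p. 24–26, Cor. 2.2 (ii) proof p. 44] [cite: Serre1972, §1.11–§1.12] [claim: Mochizuki2012, status: disputed] -/
theorem GenuineM.not_pilotKummerCompatHull_triple_of_ten_top {a b c : ℕ} (habc : IsABCTriple a b c) {l : ℕ}
    (T : Cor22.ThetaVolumeDatumAt (ratPoint ((a : ℚ) / c)) l) (u : FinitePlace ℚ) (hp2 : ratChar u ≠ 2) (hp3 : ratChar u ≠ 3)
    (hp5 : ratChar u ≠ 5) (hpl : ratChar u ≠ l) (hfloor : 10 * l + 2 ≤ ratChar u) (v : ℕ) (hv : 1 ≤ v) (hdvd : ratChar u ^ v ∣ a * b * c)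
    (hndvd : ¬ ratChar u ^ (v + 1) ∣ a * b * c) (hqv : 3 ∣ v) (h4 : 2 * l ≤ (l - 3) * v) :
    letI := T.instFieldF; letI := T.instNumberFieldF; letI := T.instAlgebraF; letI := T.instFieldK
    letI := T.instNumberFieldK; letI := T.instAlgebraK; letI := T.instFieldFbar; letI := T.instAlgebraFbar
    letI := T.instAlgebraKFbar; letI := T.instIsElliptic
    ∀ (M : Type) [Field M] [NumberField M]
      (archPk : ∀ (j : (thetaIndexOfInitial T.D).Label) (vQ : (thetaIndexOfInitial T.D).VQ),
        Set ((logShellsOfInitialDH T.D (analyticLogvVal T.K)).Packet j vQ))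
      (archSub : ∀ (j : (thetaIndexOfInitial T.D).Label) (v : (thetaIndexOfInitial T.D).V),
        Set ((logShellsOfInitialDH T.D (analyticLogvVal T.K)).Packet j ((thetaIndexOfInitial T.D).over v)))
      (Ψ : ℤ → ∀ v : (thetaIndexOfInitial T.D).V, v ∈ (thetaIndexOfInitial T.D).Vbad →
        Set ((logShellsOfInitialDH T.D (analyticLogvVal T.K)).StarPacket v))
      (act : ℤ → ∀ v : (thetaIndexOfInitial T.D).V, v ∈ (thetaIndexOfInitial T.D).Vbad →
        (logShellsOfInitialDH T.D (analyticLogvVal T.K)).StarPacket v →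
          Module.End ℚ ((logShellsOfInitialDH T.D (analyticLogvVal T.K)).StarPacket v))
      (Mmod : ℤ → ∀ j : (thetaIndexOfInitial T.D).LabelStar, Set ((logShellsOfInitialDH T.D (analyticLogvVal T.K)).GlobalPacket j.1))
      (region : ℤ → ∀ j : (thetaIndexOfInitial T.D).LabelStar, FinDivisor M → ∀ vQ : (thetaIndexOfInitial T.D).VQ,
        Set ((logShellsOfInitialDH T.D (analyticLogvVal T.K)).Packet j.1 vQ))
      (frobAdm : ℤ → ℤ → ∀ (j : (thetaIndexOfInitial T.D).Label) (vQ : (thetaIndexOfInitial T.D).VQ),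
        Set ((logShellsOfInitialDH T.D (analyticLogvVal T.K)).Packet j vQ) → Prop)
      (frobLogvol : ℤ → ℤ → ∀ (j : (thetaIndexOfInitial T.D).Label) (vQ : (thetaIndexOfInitial T.D).VQ),
        Set ((logShellsOfInitialDH T.D (analyticLogvVal T.K)).Packet j vQ) → ℝ)
      (frobΨ : ℤ → ℤ → ∀ v : (thetaIndexOfInitial T.D).V, v ∈ (thetaIndexOfInitial T.D).Vbad →
        Set ((logShellsOfInitialDH T.D (analyticLogvVal T.K)).StarPacket v))
      (frobMmod : ℤ → ℤ → ∀ j : (thetaIndexOfInitial T.D).LabelStar, Set ((logShellsOfInitialDH T.D (analyticLogvVal T.K)).GlobalPacket j.1))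
      (unitImage : ℤ → ℤ → ℕ → ∀ (j : (thetaIndexOfInitial T.D).Label) (vQ : (thetaIndexOfInitial T.D).VQ),
        Set ((logShellsOfInitialDH T.D (analyticLogvVal T.K)).Packet j vQ))
      (ballImage : ℤ → ℤ → ∀ (j : (thetaIndexOfInitial T.D).Label) (vQ : (thetaIndexOfInitial T.D).VQ),
        Set ((logShellsOfInitialDH T.D (analyticLogvVal T.K)).Packet j vQ))
      (thetaDiv : ℤ → ℤ → LgpDivisor M (thetaIndexOfInitial T.D).lstar)
      (n : ℤ) {HT : Type} {LogLink : HT → HT → Type} {IsFull : ∀ {s t : HT}, LogLink s t → Prop}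
      (lat : LGPGaussianLogThetaLattice LogLink IsFull)
      {Frd : Type} {IsoF : Frd → Frd → Type} {Ob : Frd → Type} {realify : Frd → Frd} {Strip : Type}
      {IsoS : Strip → Strip → Type} {Mv : ∀ v : (thetaIndexOfInitial T.D).V, v ∈ (thetaIndexOfInitial T.D).Vbad → Type}
      [∀ v h, Monoid (Mv v h)]
      (sig : GlobalLGPFrobenioidSignature (thetaIndexOfInitial T.D).lstar (thetaIndexOfInitial T.D).V
        (· ∈ (thetaIndexOfInitial T.D).Vbad) Frd IsoF Ob realify Strip IsoS Mv)
      (split : SplittingMonoids Mv) {ObΔ : Type} {N : ∀ v : (thetaIndexOfInitial T.D).V, v ∈ (thetaIndexOfInitial T.D).Vbad → Type}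
      [∀ v h, Monoid (N v h)] (qData : QPilotData ObΔ N)
      (qK : ∀ v : (thetaIndexOfInitial T.D).V, v ∈ (thetaIndexOfInitial T.D).Vbad →
        Set ((logShellsOfInitialDH T.D (analyticLogvVal T.K)).StarPacket v)),
      ¬ Cor312Vol.PilotKummerCompatHull
        (LatticeSituation.ofShells (logShellsOfInitialDH T.D (analyticLogvVal T.K)) M archPk archSub
          (summandPiecesPrM T.D (logvAnalyticVal_analyticLogvVal (K := T.K))).Adm (summandPiecesPrM T.D (logvAnalyticVal_analyticLogvVal (K := T.K))).logvol Ψ act Mmod region frobAdm frobLogvol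
          frobΨ frobMmod unitImage ballImage thetaDiv)
        (settingPrVolSharpM T.D (logvAnalyticVal_analyticLogvVal (K := T.K)) (tOfIdeleData T.D (ideleDataOf T.D T.isVolumeInputOf))
          (fun u x => tqM T.D (ratChar u) u (natCast_ratChar_mem u) (ideleDataOf T.D T.isVolumeInputOf) x) M archPk archSub Ψ act Mmod region n lat sig split qData
          (fun u x => tqM_ne_zero T.D (ratChar u) u (natCast_ratChar_mem u) (ideleDataOf T.D T.isVolumeInputOf) x)
          (GenuineM.finite_ratPlaces_under_S T.D).toFinset
          (fun u x hu => norm_tqM_eq_one_of_not_mem T.D (ratChar u) u (natCast_ratChar_mem u) (ideleDataOf T.D T.isVolumeInputOf) x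
            fun hx => hu ((Set.Finite.mem_toFinset _).mpr ⟨x, hx⟩)))
        (fun _ => Cor312.Setting.qRegion
          (settingPrVolSharpM T.D (logvAnalyticVal_analyticLogvVal (K := T.K)) (tOfIdeleData T.D (ideleDataOf T.D T.isVolumeInputOf))
          (fun u x => tqM T.D (ratChar u) u (natCast_ratChar_mem u) (ideleDataOf T.D T.isVolumeInputOf) x) M archPk archSub Ψ act Mmod region n lat sig split qData
          (fun u x => tqM_ne_zero T.D (ratChar u) u (natCast_ratChar_mem u) (ideleDataOf T.D T.isVolumeInputOf) x)
          (GenuineM.finite_ratPlaces_under_S T.D).toFinset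
          (fun u x hu => norm_tqM_eq_one_of_not_mem T.D (ratChar u) u (natCast_ratChar_mem u) (ideleDataOf T.D T.isVolumeInputOf) x
            fun hx => hu ((Set.Finite.mem_toFinset _).mpr ⟨x, hx⟩)))) qK := by
  letI := T.instFieldF; letI := T.instNumberFieldF; letI := T.instAlgebraF; letI := T.instFieldK
  letI := T.instNumberFieldK; letI := T.instAlgebraK; letI := T.instFieldFbar; letI := T.instAlgebraFbar
  letI := T.instAlgebraKFbar; letI := T.instIsElliptic
  have hp : (ratChar u).Prime := (inferInstance : Fact (ratChar u).Prime).out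
  -- `v_p(abc) = v`
  have habc0 : a * b * c ≠ 0 := by
    obtain ⟨ha, hb, hsum, -⟩ := habc
    exact Nat.mul_ne_zero (Nat.mul_ne_zero ha.ne' hb.ne') (by omega)
  have hfac : (a * b * c).factorization (ratChar u) = v := by
    have h1 : v ≤ (a * b * c).factorization (ratChar u) := (hp.pow_dvd_iff_le_factorization habc0).1 hdvd
    have h2 : ¬ v + 1 ≤ (a * b * c).factorization (ratChar u) := fun h' =>
      hndvd ((hp.pow_dvd_iff_le_factorization habc0).2 h')
    omega
  have hpabc : ratChar u ∣ a * b * c := (dvd_pow_self _ (by omega)).trans hdvd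
  -- `ord_p j(a/c) = −2v`: pole order exactly `2v`, and `3 ∣ ord_p j(a/c)`
  have hordeq : ∀ u' : HeightOneSpectrum (𝓞 ℚ), Rat.HeightOneSpectrum.natGenerator u' = ratChar u →
      ord ℚ u' (Cor22.jInv ((a : ℚ) / c)) = -((2 * v : ℕ) : ℤ) := by
    intro u' hu'
    rw [Cor22.ord_jInv_ratPoint_triple_eq habc u' (hu' ▸ hp2) (hu' ▸ hpabc), hu', hfac]
    push_cast
    ring
  have hord : ∀ u' : HeightOneSpectrum (𝓞 ℚ), Rat.HeightOneSpectrum.natGenerator u' = ratChar u →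
      ord ℚ u' (Cor22.jInv ((a : ℚ) / c)) ≤ -((2 * v : ℕ) : ℤ) := fun u' hu' => (hordeq u' hu').le
  have hpole : ∀ u' : HeightOneSpectrum (𝓞 ℚ), Rat.HeightOneSpectrum.natGenerator u' = ratChar u →
      ord ℚ u' (Cor22.jInv ((a : ℚ) / c)) < 0 := fun u' hu' => by
    rw [hordeq u' hu']; push_cast; omega
  have hordq : ∀ u' : HeightOneSpectrum (𝓞 ℚ), Rat.HeightOneSpectrum.natGenerator u' = ratChar u →
      (3 : ℤ) ∣ ord ℚ u' (Cor22.jInv ((a : ℚ) / c)) := fun u' hu' => by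
    exact_mod_cast Cor22.natCast_dvd_ord_jInv_ratPoint_triple habc hp2 hpabc (n := 3) (by rw [hfac]; exact hqv) u' hu'
  -- the Tate-exact local type: every `w | p` of `T.K` has `e(w | p) ∣ 10·l ≤ p − 2`
  have hnot : ratChar u ∉ ({2, 3, 5, l} : Finset ℕ) := by
    simp only [Finset.mem_insert, Finset.mem_singleton, not_or]
    exact ⟨hp2, hp3, hp5, hpl⟩
  have hl0 : 0 < l := by
    have := T.D.five_le_l
    omega
  have hloc : ∀ w : HeightOneSpectrum (𝓞 T.K), residueChar T.K w = ratChar u → w.asIdeal.ramificationIdx ℤ ≤ ratChar u - 2 :=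
    fun w hw => (Nat.le_of_dvd (by omega) (T.ramificationIdx_int_dvd_ten_mul_ratPoint' hnot hpole hordq w hw)).trans (by omega)
  -- the top label `i₀ = l⋆ − 1`
  have hl : l.Prime := T.D.l_prime
  have hl5 : 5 ≤ l := T.D.five_le_l
  have hodd : l % 2 = 1 := by
    rcases hl.eq_two_or_odd with h2 | h2
    · omega
    · exact h2
  have htop : 2 * l ≤ ((l - 1) / 2 - 1) * (2 * v) :=
    TameRobust.top_label_test (h := 2 * v) hodd (by omega) (by nlinarith [h4])
  exact GenuineM.not_pilotKummerCompatHull_ratPoint_of_localType T u hp2 hpl hloc (2 * v) (by omega) hord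
    ((l - 1) / 2 - 1) (by omega) htop

/-- **M LINE, abc-TRIPLE form, TOP LABEL `j = l⋆`, prime floor `6·l + 2`, Tate-exact local type.** `a + b = c` coprime, `λ = a/c`, `T` a genuine
Θ-volume datum at `(ratPoint (a/c), l)`, a finite place `u` of `ℚ` with `p = p_u ∉ {2, 3, 5, l}`, **`6·l + 2 ≤ p`**, `p^v ∣ abc`, `p^{v+1} ∤ abc`
(`v = v_p(abc) ≥ 1`) with **`5 ∣ v`**, and **`2l ≤ (l−3)·v`**. THEN ¬ S_H at the summand-route M-level sharp setting of `T`'s own read-off ideles (pinned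
reading) for every choice of the free context binders and Kummer datum — UNCONDITIONALLY: `ord_p j(a/c) = −2v` (`Cor22.ord_jInv_ratPoint_triple_eq`), so
`5 ∣ ord_p j(a/c)` and every `w | p` of `T.K` has `e(w | p) ∣ 6·l ≤ p − 2` (`Cor22.ThetaVolumeDatumAt.ramificationIdx_int_dvd_six_mul_ratPoint'`, Serre 1972 n° 1.12),
and `GenuineM.not_pilotKummerCompatHull_ratPoint_of_localType` fires at the top label. [cite: Mochizuki2012, IUTchIII Cor. 3.12 Step (xi-f) p. 184;
IUTchIV Thm. 1.10 proof Steps (ii)–(iii) p. 24–26, Cor. 2.2 (ii) proof p. 44] [cite: Serre1972, §1.11–§1.12] [claim: Mochizuki2012, status: disputed] -/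
theorem GenuineM.not_pilotKummerCompatHull_triple_of_six_top {a b c : ℕ} (habc : IsABCTriple a b c) {l : ℕ}
    (T : Cor22.ThetaVolumeDatumAt (ratPoint ((a : ℚ) / c)) l) (u : FinitePlace ℚ) (hp2 : ratChar u ≠ 2) (hp3 : ratChar u ≠ 3)
    (hp5 : ratChar u ≠ 5) (hpl : ratChar u ≠ l) (hfloor : 6 * l + 2 ≤ ratChar u) (v : ℕ) (hv : 1 ≤ v) (hdvd : ratChar u ^ v ∣ a * b * c)
    (hndvd : ¬ ratChar u ^ (v + 1) ∣ a * b * c) (hqv : 5 ∣ v) (h4 : 2 * l ≤ (l - 3) * v) :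
    letI := T.instFieldF; letI := T.instNumberFieldF; letI := T.instAlgebraF; letI := T.instFieldK
    letI := T.instNumberFieldK; letI := T.instAlgebraK; letI := T.instFieldFbar; letI := T.instAlgebraFbar
    letI := T.instAlgebraKFbar; letI := T.instIsElliptic
    ∀ (M : Type) [Field M] [NumberField M]
      (archPk : ∀ (j : (thetaIndexOfInitial T.D).Label) (vQ : (thetaIndexOfInitial T.D).VQ),
        Set ((logShellsOfInitialDH T.D (analyticLogvVal T.K)).Packet j vQ))
      (archSub : ∀ (j : (thetaIndexOfInitial T.D).Label) (v : (thetaIndexOfInitial T.D).V),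
        Set ((logShellsOfInitialDH T.D (analyticLogvVal T.K)).Packet j ((thetaIndexOfInitial T.D).over v)))
      (Ψ : ℤ → ∀ v : (thetaIndexOfInitial T.D).V, v ∈ (thetaIndexOfInitial T.D).Vbad →
        Set ((logShellsOfInitialDH T.D (analyticLogvVal T.K)).StarPacket v))
      (act : ℤ → ∀ v : (thetaIndexOfInitial T.D).V, v ∈ (thetaIndexOfInitial T.D).Vbad →
        (logShellsOfInitialDH T.D (analyticLogvVal T.K)).StarPacket v →
          Module.End ℚ ((logShellsOfInitialDH T.D (analyticLogvVal T.K)).StarPacket v))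
      (Mmod : ℤ → ∀ j : (thetaIndexOfInitial T.D).LabelStar, Set ((logShellsOfInitialDH T.D (analyticLogvVal T.K)).GlobalPacket j.1))
      (region : ℤ → ∀ j : (thetaIndexOfInitial T.D).LabelStar, FinDivisor M → ∀ vQ : (thetaIndexOfInitial T.D).VQ,
        Set ((logShellsOfInitialDH T.D (analyticLogvVal T.K)).Packet j.1 vQ))
      (frobAdm : ℤ → ℤ → ∀ (j : (thetaIndexOfInitial T.D).Label) (vQ : (thetaIndexOfInitial T.D).VQ),
        Set ((logShellsOfInitialDH T.D (analyticLogvVal T.K)).Packet j vQ) → Prop)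
      (frobLogvol : ℤ → ℤ → ∀ (j : (thetaIndexOfInitial T.D).Label) (vQ : (thetaIndexOfInitial T.D).VQ),
        Set ((logShellsOfInitialDH T.D (analyticLogvVal T.K)).Packet j vQ) → ℝ)
      (frobΨ : ℤ → ℤ → ∀ v : (thetaIndexOfInitial T.D).V, v ∈ (thetaIndexOfInitial T.D).Vbad →
        Set ((logShellsOfInitialDH T.D (analyticLogvVal T.K)).StarPacket v))
      (frobMmod : ℤ → ℤ → ∀ j : (thetaIndexOfInitial T.D).LabelStar, Set ((logShellsOfInitialDH T.D (analyticLogvVal T.K)).GlobalPacket j.1))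
      (unitImage : ℤ → ℤ → ℕ → ∀ (j : (thetaIndexOfInitial T.D).Label) (vQ : (thetaIndexOfInitial T.D).VQ),
        Set ((logShellsOfInitialDH T.D (analyticLogvVal T.K)).Packet j vQ))
      (ballImage : ℤ → ℤ → ∀ (j : (thetaIndexOfInitial T.D).Label) (vQ : (thetaIndexOfInitial T.D).VQ),
        Set ((logShellsOfInitialDH T.D (analyticLogvVal T.K)).Packet j vQ))
      (thetaDiv : ℤ → ℤ → LgpDivisor M (thetaIndexOfInitial T.D).lstar)
      (n : ℤ) {HT : Type} {LogLink : HT → HT → Type} {IsFull : ∀ {s t : HT}, LogLink s t → Prop}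
      (lat : LGPGaussianLogThetaLattice LogLink IsFull)
      {Frd : Type} {IsoF : Frd → Frd → Type} {Ob : Frd → Type} {realify : Frd → Frd} {Strip : Type}
      {IsoS : Strip → Strip → Type} {Mv : ∀ v : (thetaIndexOfInitial T.D).V, v ∈ (thetaIndexOfInitial T.D).Vbad → Type}
      [∀ v h, Monoid (Mv v h)]
      (sig : GlobalLGPFrobenioidSignature (thetaIndexOfInitial T.D).lstar (thetaIndexOfInitial T.D).V
        (· ∈ (thetaIndexOfInitial T.D).Vbad) Frd IsoF Ob realify Strip IsoS Mv)
      (split : SplittingMonoids Mv) {ObΔ : Type} {N : ∀ v : (thetaIndexOfInitial T.D).V, v ∈ (thetaIndexOfInitial T.D).Vbad → Type}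
      [∀ v h, Monoid (N v h)] (qData : QPilotData ObΔ N)
      (qK : ∀ v : (thetaIndexOfInitial T.D).V, v ∈ (thetaIndexOfInitial T.D).Vbad →
        Set ((logShellsOfInitialDH T.D (analyticLogvVal T.K)).StarPacket v)),
      ¬ Cor312Vol.PilotKummerCompatHull
        (LatticeSituation.ofShells (logShellsOfInitialDH T.D (analyticLogvVal T.K)) M archPk archSub
          (summandPiecesPrM T.D (logvAnalyticVal_analyticLogvVal (K := T.K))).Adm (summandPiecesPrM T.D (logvAnalyticVal_analyticLogvVal (K := T.K))).logvol Ψ act Mmod region frobAdm frobLogvol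
          frobΨ frobMmod unitImage ballImage thetaDiv)
        (settingPrVolSharpM T.D (logvAnalyticVal_analyticLogvVal (K := T.K)) (tOfIdeleData T.D (ideleDataOf T.D T.isVolumeInputOf))
          (fun u x => tqM T.D (ratChar u) u (natCast_ratChar_mem u) (ideleDataOf T.D T.isVolumeInputOf) x) M archPk archSub Ψ act Mmod region n lat sig split qData
          (fun u x => tqM_ne_zero T.D (ratChar u) u (natCast_ratChar_mem u) (ideleDataOf T.D T.isVolumeInputOf) x)
          (GenuineM.finite_ratPlaces_under_S T.D).toFinset
          (fun u x hu => norm_tqM_eq_one_of_not_mem T.D (ratChar u) u (natCast_ratChar_mem u) (ideleDataOf T.D T.isVolumeInputOf) x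
            fun hx => hu ((Set.Finite.mem_toFinset _).mpr ⟨x, hx⟩)))
        (fun _ => Cor312.Setting.qRegion
          (settingPrVolSharpM T.D (logvAnalyticVal_analyticLogvVal (K := T.K)) (tOfIdeleData T.D (ideleDataOf T.D T.isVolumeInputOf))
          (fun u x => tqM T.D (ratChar u) u (natCast_ratChar_mem u) (ideleDataOf T.D T.isVolumeInputOf) x) M archPk archSub Ψ act Mmod region n lat sig split qData
          (fun u x => tqM_ne_zero T.D (ratChar u) u (natCast_ratChar_mem u) (ideleDataOf T.D T.isVolumeInputOf) x)
          (GenuineM.finite_ratPlaces_under_S T.D).toFinset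
          (fun u x hu => norm_tqM_eq_one_of_not_mem T.D (ratChar u) u (natCast_ratChar_mem u) (ideleDataOf T.D T.isVolumeInputOf) x
            fun hx => hu ((Set.Finite.mem_toFinset _).mpr ⟨x, hx⟩)))) qK := by
  letI := T.instFieldF; letI := T.instNumberFieldF; letI := T.instAlgebraF; letI := T.instFieldK
  letI := T.instNumberFieldK; letI := T.instAlgebraK; letI := T.instFieldFbar; letI := T.instAlgebraFbar
  letI := T.instAlgebraKFbar; letI := T.instIsElliptic
  have hp : (ratChar u).Prime := (inferInstance : Fact (ratChar u).Prime).out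
  -- `v_p(abc) = v`
  have habc0 : a * b * c ≠ 0 := by
    obtain ⟨ha, hb, hsum, -⟩ := habc
    exact Nat.mul_ne_zero (Nat.mul_ne_zero ha.ne' hb.ne') (by omega)
  have hfac : (a * b * c).factorization (ratChar u) = v := by
    have h1 : v ≤ (a * b * c).factorization (ratChar u) := (hp.pow_dvd_iff_le_factorization habc0).1 hdvd
    have h2 : ¬ v + 1 ≤ (a * b * c).factorization (ratChar u) := fun h' =>
      hndvd ((hp.pow_dvd_iff_le_factorization habc0).2 h')
    omega
  have hpabc : ratChar u ∣ a * b * c := (dvd_pow_self _ (by omega)).trans hdvd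
  -- `ord_p j(a/c) = −2v`: pole order exactly `2v`, and `5 ∣ ord_p j(a/c)`
  have hordeq : ∀ u' : HeightOneSpectrum (𝓞 ℚ), Rat.HeightOneSpectrum.natGenerator u' = ratChar u →
      ord ℚ u' (Cor22.jInv ((a : ℚ) / c)) = -((2 * v : ℕ) : ℤ) := by
    intro u' hu'
    rw [Cor22.ord_jInv_ratPoint_triple_eq habc u' (hu' ▸ hp2) (hu' ▸ hpabc), hu', hfac]
    push_cast
    ring
  have hord : ∀ u' : HeightOneSpectrum (𝓞 ℚ), Rat.HeightOneSpectrum.natGenerator u' = ratChar u →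
      ord ℚ u' (Cor22.jInv ((a : ℚ) / c)) ≤ -((2 * v : ℕ) : ℤ) := fun u' hu' => (hordeq u' hu').le
  have hpole : ∀ u' : HeightOneSpectrum (𝓞 ℚ), Rat.HeightOneSpectrum.natGenerator u' = ratChar u →
      ord ℚ u' (Cor22.jInv ((a : ℚ) / c)) < 0 := fun u' hu' => by
    rw [hordeq u' hu']; push_cast; omega
  have hordq : ∀ u' : HeightOneSpectrum (𝓞 ℚ), Rat.HeightOneSpectrum.natGenerator u' = ratChar u →
      (5 : ℤ) ∣ ord ℚ u' (Cor22.jInv ((a : ℚ) / c)) := fun u' hu' => by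
    exact_mod_cast Cor22.natCast_dvd_ord_jInv_ratPoint_triple habc hp2 hpabc (n := 5) (by rw [hfac]; exact hqv) u' hu'
  -- the Tate-exact local type: every `w | p` of `T.K` has `e(w | p) ∣ 6·l ≤ p − 2`
  have hnot : ratChar u ∉ ({2, 3, 5, l} : Finset ℕ) := by
    simp only [Finset.mem_insert, Finset.mem_singleton, not_or]
    exact ⟨hp2, hp3, hp5, hpl⟩
  have hl0 : 0 < l := by
    have := T.D.five_le_l
    omega
  have hloc : ∀ w : HeightOneSpectrum (𝓞 T.K), residueChar T.K w = ratChar u → w.asIdeal.ramificationIdx ℤ ≤ ratChar u - 2 :=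
    fun w hw => (Nat.le_of_dvd (by omega) (T.ramificationIdx_int_dvd_six_mul_ratPoint' hnot hpole hordq w hw)).trans (by omega)
  -- the top label `i₀ = l⋆ − 1`
  have hl : l.Prime := T.D.l_prime
  have hl5 : 5 ≤ l := T.D.five_le_l
  have hodd : l % 2 = 1 := by
    rcases hl.eq_two_or_odd with h2 | h2
    · omega
    · exact h2
  have htop : 2 * l ≤ ((l - 1) / 2 - 1) * (2 * v) :=
    TameRobust.top_label_test (h := 2 * v) hodd (by omega) (by nlinarith [h4])
  exact GenuineM.not_pilotKummerCompatHull_ratPoint_of_localType T u hp2 hpl hloc (2 * v) (by omega) hord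
    ((l - 1) / 2 - 1) (by omega) htop

end Summit.ABC.IUTFork.Conditional

end
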